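/- Copyright: the b2b-balaban cell (near-miss cell 7), T⁴-continuum fan-out, lineage t4-ne7b-p1 (row NE7b OWNER + CRUX
PROVER NE7b), gen 45: (α)-M5-3a «THE DISCOUNT CHARGE».  Released under the licence of the surrounding project. -/
import Summits.QuantumFields.BalabanUV.T4Continuum.Support.HistoryTreeShapeLE
import Summits.QuantumFields.BalabanUV.T4Continuum.Support.HistoryConstants

/-!
# History banking, M5-3a: THE COUNT's DISCOUNT `Ξ = 8∕E₂·totalCostT + 4·partnerAges` IS PAYABLE PER BIRTH AND PER
RENEWAL — the charging lemma of the credit reading (re-open object (α) of row NE7b, `SCOPE-alpha.md` §5 row M5, part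
M5-3 «the credit reading», first half; ruling R-OWNER-45-1, owner gen 45)

Summits-side support leaf of the T⁴-continuum cell (rung (B)+1 on a FINITE torus only; NOT infinite volume, NOT the
mass gap, NOT the Clay statement; NOT a proof of the spine estimate NE7b — the cell's OWN estimate, NOT PRINTED, NOT
PROVED).  [folklore] finite bookkeeping over the lineage's own typed ledger (`T4PersistenceDictionary.Gen`,
`T4PartnerMultiplicity.{partnerAges, windowSurplus}`, `T4PrintedShapeBanking.{floorK, sz, wt, dictW}` with the
(2.9)-bounds `sum_floorK_le` ∕ `sum_supp_sz_le`, `T4TaggedShapeBanking.dictWT`, `T4BankedInduction.credits`,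
`HistoryBankingLE.{ConsistentTLE, evCost, totalCostT}`, `HistoryTreeShapeLE.partnerAges_le_windowSurplusTLE`,
`HistoryConstants.pcredit`); no `[cite:]` tag, nothing printed
asserted, no `def … : Prop` fact of Bałaban's (`RoundingRoom` is a displayed HYPOTHESIS structure, like
`HistoryConstants.Dominates`, inhabited by toy data in the sibling's sanity section), zero `sorry`.

WHY.  After M5-2 (rows S18–S20) the price sentence `priceM` of the `κ := costT` witness (`HistoryRealiseCellsRunApexT3bWTV(S)`)
reads, per live member of a bad term, ONE thing that is not kernel: the CREDIT side — M2 brick B's event product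
`evProd (fB K) (fR K) (toPGen …)` (`B16HistoryInputFamily`) against print's booked credits `e^{−credits (pcredit O C g ∘ Prod.fst) (genT …)}`
TIMES the count's displayed discount `e^{−Ξ}`, `Ξ = 8∕C.E₂·totalCostT Prod.fst C K (R K) q.2 + 4·partnerAges (PEv.step ∘ Prod.fst) q.2`
(`HistoryAssemblyMultInstance`, T-NE7b-14).  The refuter's located verdict (PRICING-NE7b v12 F65 on the owner's Q-44-1): `Ξ`
is NOT payable «per birth only» K-uniformly (a structure may renew any number `r` of times; `Ξ` grows with `r`, the births'
room does not).  THIS FILE is the combinatorial half of the owner's answer R-OWNER-45-1: `Ξ` IS payable PER EVENT — every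
birth and renewal pays its OWN share, every MERGER's share is paid by the ROOT BIRTH OF THE ABSORBED (later-born) PARTNER,
each root being absorbed at most once (the mechanism of `T4BankedInduction.absorbed`, print's surplus (1.87) p. 386) —
with shares that are RUN-LEVEL LETTERS (functions of the event's shape and of `C`, `L`, `R` only).  The sibling
`HistoryBankingCreditRead` (M5-3b) turns the charge into `evProd ≤ e^{−credits (pcredit)}·e^{−Ξ}` under displayed event-wise
readings of print's SHARP factors with room, the renewal's room being print's own ROUNDING of [B16] p. 383 (after (1.78)):
«This is the largest factor among all the small factors … We assume that 2p₁ − (d + 5)r₀ > p₀, and we estimate the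
factors by exp(−p₀(g_j))» (typed `B16Sect1Kernels.lfFactor178` ∕ `ExponentProviso383` ∕ `exp_lfFactor_le_exp_neg_p0`;
a LOCATOR — nothing of it asserted here).

WHAT.  §1 **`sum_window_eq_span_add_windowSurplus`** (`WF`: `Σ_{e ∈ events} W e = (reach − rootStep) + windowSurplus` —
the windows tile the life once and the double-pending steps once more) and, with leaf-03's
`HistoryTreeShapeLE.partnerAges_le_windowSurplusTLE`, **`partnerAges_le_sum_window`**.  §2
**`step_le_place`** (every event's window opens no earlier than its own step).  §3 the DISCOUNT SHARE **`dshare C L R e`**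
`= 8·W e·(L·R_s)^{q′} + 8(E₃∕E₂)(L·R_s)^{q′}·wt e + 4·W e` (`s = e.step`), `mshare C L R s := dshare C L R (s, 2, 0)`,
**`evCost_le`** ((2.9)), **`discount_evCost_le_dshare`**, **`discount_le_sum_dshare`**: `8∕E₂·totalCostT + 4·partnerAges ≤
Σ_e dshare (sh e)`.  §4 the SHARP-EXPONENT letters `sharpT sB sR` (birth `sB step fat`, renewal `sR (step − 1)`, merger `0`),
the junction **`RoundingRoom C O L K R g sB sR`** (two clauses shaped like the END's pay inequalities `Hb`∕`Hr`∕`Hm` of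
`HistoryBankingLE`), THE CHARGE **`credits_add_sum_dshare_le_sharps`** (induction carrying «one merger share at any step
`s ∈ [rootStep, K]`»: at a merger the absorbed partner's invariant, taken at the merger step, pays the merger).  §5
**`credits_add_discount_le_sharps`** ∕ **`exp_neg_sharps_le`**: `credits (pcredit ∘ sh) G + Ξ ≤ Σ_e sharpT (sh e)`.  (Sanity:
the sibling `HistoryBankingCreditRead` §4 inhabits `RoundingRoom` and runs the whole chain on toy data.)

HONEST SCOPE.  Bookkeeping over OUR carriers; `RoundingRoom` is a HYPOTHESIS shape (print's two rounding sentences READ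
WITH ROOM — R-class); nothing of H3 ∕ (B) ∕ BetaPertH is discharged; BY-NAME EFFECT ON THE WALL: none by this file alone.
NE7b NOT proved; spine 0∕9.  HONEST DEPENDENCY (cell): continuum YM on T⁴ ⇐ BetaPertH ∧ nine spine estimates (0/9 proved);
BetaPertH ⇐ (D1) ∧ (D4) ∧ CAP+tail; G-an2-4 gates asym, D1 and NE2/3/4.  This file changes none of it.
-/

open Finset
open Literature.MathematicalPhysics.QuantumFieldTheory.Balaban1983to89
open T4PersistenceDictionary T4PrintedShapeBanking T4BankedInduction T4TaggedShapeBanking T4PartnerMultiplicity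
open Summit.QuantumFields.BalabanUV.T4Continuum.HistoryBankingLE
open Summit.QuantumFields.BalabanUV.T4Continuum.HistoryConstants

namespace Summit.QuantumFields.BalabanUV.T4Continuum.HistoryBankingDiscountCharge

noncomputable section

/-! ## §1 The windows tile the life once and the double-pending steps once more; partner ages -/

section Windows

variable {ε : Type*} [DecidableEq ε]

/-- **THE WINDOW IDENTITY**: for a well-formed genealogy, the total booked window length is the span of the life plus
the window surplus — `Σ_{e ∈ events} W e = (reach W G − rootStep G) + windowSurplus W G`. [folklore] -/
theorem sum_window_eq_span_add_windowSurplus (W : ε → ℕ) :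
    ∀ {G : Gen ε}, G.WF W → (∑ e ∈ G.events, W e) = (G.reach W - G.rootStep) + windowSurplus W G
  | Gen.born b j, _ => by simp
  | Gen.renew G e h, hW => by
      simp only [Gen.WF] at hW
      obtain ⟨hG, he, hr, hh⟩ := hW
      have ih := sum_window_eq_span_add_windowSurplus W hG
      have hrr := rootStep_le_reach_of_wf W hG
      rw [Gen.events_renew, sum_insert he, ih]
      simp only [Gen.reach_renew, Gen.rootStep_renew, windowSurplus_renew]
      omega
  | Gen.merge X Y e, hW => by
      simp only [Gen.WF] at hW
      obtain ⟨hX, hY, heX, heY, hXY, hx, hy⟩ := hW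
      have ihX := sum_window_eq_span_add_windowSurplus W hX
      have ihY := sum_window_eq_span_add_windowSurplus W hY
      have hrX := rootStep_le_reach_of_wf W hX
      have hrY := rootStep_le_reach_of_wf W hY
      have he : e ∉ X.events ∪ Y.events := by simp [heX, heY]
      rw [Gen.events_merge, sum_insert he, sum_union hXY, ihX, ihY]
      simp only [Gen.reach_merge, Gen.rootStep_merge, windowSurplus_merge]
      rcases le_total (X.reach W) (Y.reach W) with h1 | h1 <;>
        rcases le_total X.rootStep Y.rootStep with h2 | h2 <;>
        simp only [max_eq_right h1, max_eq_left h1, min_eq_left h1, min_eq_right h1, max_eq_right h2,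
          max_eq_left h2, min_eq_left h2, min_eq_right h2] <;> omega

variable {sh : ε → PEv} {C : T4PrintedShapeBanking.Consts} {K : ℕ} {R : ℕ → ℕ}

/-- **PARTNER AGES ≤ TOTAL WINDOW LENGTH** (`WF` + `ConsistentTLE`). [folklore] -/
theorem partnerAges_le_sum_window {G : Gen ε} (hW : G.WF (dictWT sh R C.n₁)) (hc : ConsistentTLE sh C K R G) :
    partnerAges (PEv.step ∘ sh) G ≤ ∑ e ∈ G.events, dictWT sh R C.n₁ e := by
  have h1 := sum_window_eq_span_add_windowSurplus (dictWT sh R C.n₁) hW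
  have h2 := HistoryTreeShapeLE.partnerAges_le_windowSurplusTLE hc
  omega

end Windows

/-! ## §2 Every event's window opens no earlier than the event's own step -/

section Place

variable {ε : Type*} [DecidableEq ε] {sh : ε → PEv} {C : T4PrintedShapeBanking.Consts} {K : ℕ} {R : ℕ → ℕ}

/-- under `ConsistentTLE`, `(sh e).step ≤ G.place W e` for every event `e` (births and renewals are placed AT their
step, mergers at the later partner reach, which is beyond the merger step). [folklore] -/
theorem step_le_place :
    ∀ {G : Gen ε}, ConsistentTLE sh C K R G → ∀ e ∈ G.events, (sh e).step ≤ G.place (dictWT sh R C.n₁) e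
  | Gen.born b j, hc, e, he => by
      simp only [ConsistentTLE] at hc
      simp only [Gen.events_born, mem_singleton] at he
      subst he
      rw [Gen.place_born]
      exact hc.2.1.le
  | Gen.renew G e h, hc, e', he' => by
      simp only [ConsistentTLE] at hc
      obtain ⟨hG, -, hs, -, -⟩ := hc
      rw [Gen.place_renew]
      split_ifs with h1
      · subst h1; exact hs.le
      · rw [Gen.events_renew, mem_insert] at he'
        exact step_le_place hG e' (he'.resolve_left h1)
  | Gen.merge X Y e, hc, e', he' => by
      simp only [ConsistentTLE] at hc
      obtain ⟨hX, hY, -, -, hx', -, hy', -⟩ := hc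
      rw [Gen.place_merge]
      split_ifs with h1 h2
      · subst h1
        exact hx'.le.trans (le_max_left _ _)
      · exact step_le_place hX e' h2
      · rw [Gen.events_merge, mem_insert, mem_union] at he'
        have he'Y : e' ∈ Y.events := by tauto
        exact step_le_place hY e' he'Y

end Place

/-! ## §3 The per-event discount share and `Ξ ≤ Σ_e dshare` -/

section Share

variable (C : T4PrintedShapeBanking.Consts) (L : ℕ) (R : ℕ → ℕ)

/-- **THE DISCOUNT SHARE OF AN EVENT** (run-level letters; `s = e.step`, `W e = dictW R C.n₁ e`):
`8·W e·(L·R_s)^{q′} + 8·(E₃∕E₂)·(L·R_s)^{q′}·wt e + 4·W e` — `8∕E₂` times the (2.9)-bound of the event's booked cost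
(`evCost_le`) plus `4` per window step. [folklore] -/
def dshare (e : PEv) : ℝ :=
  8 * (dictW R C.n₁ e : ℝ) * ((L : ℝ) * R e.step) ^ C.q' +
    8 * (C.E₃ / C.E₂) * (((L : ℝ) * R e.step) ^ C.q' * wt C e) + 4 * (dictW R C.n₁ e : ℝ)

/-- **THE SHARE OF A MERGER AT STEP `s`**: `dshare` of the merger shape `(s, 2, 0)` —
`8·(n₁ + R_s)·(L·R_s)^{q′} + 8·(E₃∕E₂)·(L·R_s)^{q′}·dC + 4·(n₁ + R_s)`. [folklore] -/
def mshare (s : ℕ) : ℝ := dshare C L R ((s, 2, 0) : PEv)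

variable {C L R}

/-- shares are nonnegative (`E₂, E₃ ≥ 0`) [folklore] -/
theorem dshare_nonneg (hE₂ : 0 ≤ C.E₂) (hE₃ : 0 ≤ C.E₃) (e : PEv) : 0 ≤ dshare C L R e := by
  unfold dshare
  have := wt_nonneg C e
  positivity

/-- merger shares are nonnegative [folklore] -/
theorem mshare_nonneg (hE₂ : 0 ≤ C.E₂) (hE₃ : 0 ≤ C.E₃) (s : ℕ) : 0 ≤ mshare C L R s :=
  dshare_nonneg hE₂ hE₃ _

/-- a merger-shaped event's share is the merger share at its step (the share reads a kind-`2` event only through its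
step). [folklore] -/
theorem dshare_kind2 {e : PEv} (h : e.kind = 2) : dshare C L R e = mshare C L R e.step := by
  have hk : PEv.kind ((e.step, 2, 0) : PEv) = 2 := rfl
  unfold mshare dshare
  rw [dictW_kind2 h, dictW_kind2 hk, wt_kind2 h, wt_kind2 hk]
  rfl

variable {ε : Type*} [DecidableEq ε] {sh : ε → PEv} {K : ℕ} {g : ℕ → ℝ} {β' β₀ : ℝ}

omit [DecidableEq ε] in
/-- **THE BOOKED COST OF AN EVENT PLACED AT `p ≥ e.step`** is at most `W e·E₂(L·R_s)^{q′} + E₃(L·R_s)^{q′}·wt e`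
((2.9): `T4PrintedShapeBanking.sum_floorK_le`, `sum_supp_sz_le`). [folklore] -/
theorem evCost_le (h29 : B14FlowStep.FlowIneq29 R g L β' β₀ K) (hL : 1 ≤ L) (hE₂ : 0 ≤ C.E₂) (hE₃ : 0 ≤ C.E₃)
    {p : ℕ} {e : ε} (hp : (sh e).step ≤ p) :
    evCost sh C K R p e ≤ (dictWT sh R C.n₁ e : ℝ) * (C.E₂ * ((L : ℝ) * R (sh e).step) ^ C.q') +
      C.E₃ * ((L : ℝ) * R (sh e).step) ^ C.q' * wt C (sh e) := by
  unfold evCost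
  refine add_le_add ?_ (sum_supp_sz_le h29 hE₃ (sh e))
  have h := sum_floorK_le h29 hL hE₂ (s := (sh e).step) (T := Finset.Ico p (p + dictWT sh R C.n₁ e))
    fun n hn => hp.trans (mem_Ico.1 hn).1
  rw [Nat.card_Ico, Nat.add_sub_cancel_left] at h
  exact h

omit [DecidableEq ε] in
/-- **THE DISCOUNT OF ONE EVENT IS AT MOST ITS SHARE**: `8∕E₂·evCost p e + 4·W e ≤ dshare (sh e)` for `p ≥ e.step`
(`E₂ > 0`). [folklore] -/
theorem discount_evCost_le_dshare (h29 : B14FlowStep.FlowIneq29 R g L β' β₀ K) (hL : 1 ≤ L) (hE₂ : 0 < C.E₂)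
    (hE₃ : 0 ≤ C.E₃) {p : ℕ} {e : ε} (hp : (sh e).step ≤ p) :
    8 / C.E₂ * evCost sh C K R p e + 4 * (dictWT sh R C.n₁ e : ℝ) ≤ dshare C L R (sh e) := by
  have h8 : 0 ≤ 8 / C.E₂ := by positivity
  have h := mul_le_mul_of_nonneg_left (evCost_le h29 hL hE₂.le hE₃ hp) h8
  have key : 8 / C.E₂ * ((dictWT sh R C.n₁ e : ℝ) * (C.E₂ * ((L : ℝ) * R (sh e).step) ^ C.q') +
      C.E₃ * ((L : ℝ) * R (sh e).step) ^ C.q' * wt C (sh e)) =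
      8 * (dictW R C.n₁ (sh e) : ℝ) * ((L : ℝ) * R (sh e).step) ^ C.q' +
        8 * (C.E₃ / C.E₂) * (((L : ℝ) * R (sh e).step) ^ C.q' * wt C (sh e)) := by
    have hE : C.E₂ ≠ 0 := hE₂.ne'
    calc 8 / C.E₂ * ((dictWT sh R C.n₁ e : ℝ) * (C.E₂ * ((L : ℝ) * R (sh e).step) ^ C.q') +
          C.E₃ * ((L : ℝ) * R (sh e).step) ^ C.q' * wt C (sh e))
        = 8 * (dictW R C.n₁ (sh e) : ℝ) * ((L : ℝ) * R (sh e).step) ^ C.q' * (C.E₂ / C.E₂) +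
          8 * (C.E₃ / C.E₂) * (((L : ℝ) * R (sh e).step) ^ C.q' * wt C (sh e)) := by rw [dictWT_apply]; ring
      _ = _ := by rw [div_self hE, mul_one]
  unfold dshare
  rw [key] at h
  linarith

/-- **`Ξ ≤ Σ_e dshare`**: the count's displayed discount of a `ConsistentTLE`, well-formed genealogy is at most the sum
of its events' shares — `totalCostT` IS the sum of the events' booked costs (each placed no earlier than its step, §2),
and `4·partnerAges ≤ 4·Σ_e W e` (§1). [folklore] -/
theorem discount_le_sum_dshare (h29 : B14FlowStep.FlowIneq29 R g L β' β₀ K) (hL : 1 ≤ L) (hE₂ : 0 < C.E₂)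
    (hE₃ : 0 ≤ C.E₃) {G : Gen ε} (hW : G.WF (dictWT sh R C.n₁)) (hc : ConsistentTLE sh C K R G) :
    8 / C.E₂ * totalCostT sh C K R G + 4 * (partnerAges (PEv.step ∘ sh) G : ℝ) ≤
      ∑ e ∈ G.events, dshare C L R (sh e) := by
  have hpa : (partnerAges (PEv.step ∘ sh) G : ℝ) ≤ ∑ e ∈ G.events, (dictWT sh R C.n₁ e : ℝ) := by
    exact_mod_cast partnerAges_le_sum_window hW hc
  calc 8 / C.E₂ * totalCostT sh C K R G + 4 * (partnerAges (PEv.step ∘ sh) G : ℝ)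
      ≤ 8 / C.E₂ * totalCostT sh C K R G + 4 * ∑ e ∈ G.events, (dictWT sh R C.n₁ e : ℝ) := by linarith
    _ = ∑ e ∈ G.events, (8 / C.E₂ * evCost sh C K R (G.place (dictWT sh R C.n₁) e) e +
          4 * (dictWT sh R C.n₁ e : ℝ)) := by
        rw [totalCostT, mul_sum, mul_sum, ← sum_add_distrib]
    _ ≤ ∑ e ∈ G.events, dshare C L R (sh e) :=
        sum_le_sum fun e he => discount_evCost_le_dshare h29 hL hE₂ hE₃ (step_le_place hc e he)

end Share

/-! ## §4 The sharp-exponent letters, the displayed rounding-with-room junction, and THE CHARGE -/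

section Charge

/-- **THE SHARP EXPONENT OF AN EVENT** (letters): a birth of class `d′` at step `j` reads `sB j d′` (the exponent of the
«fundamental large field factor» (1.77)∕p. 381 before print rounds it to `½γ₀A₁²p₀²(d′+1) + 2p₀` in (1.79) p. 383), a
renewal at step `h + 1` reads `sR h` (the exponent of the largest preparatory factor of p. 383 before print rounds it to
`p₀(g_h)`: «we estimate the factors by exp(−p₀(g_j))»), a merger reads `0`.  VALUES are the supplier's (balaban-calc ∕
the reading of (B)); nothing is fixed here. [folklore] -/
def sharpT (sB : ℕ → ℕ → ℝ) (sR : ℕ → ℝ) (e : PEv) : ℝ :=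
  if e.kind = 0 then sB e.step e.fat else if e.kind = 1 then sR (e.step - 1) else 0

variable {sB : ℕ → ℕ → ℝ} {sR : ℕ → ℝ}

/-- sharp exponent of a birth [folklore] -/
theorem sharpT_kind0 {e : PEv} (h : e.kind = 0) : sharpT sB sR e = sB e.step e.fat := by simp [sharpT, h]

/-- sharp exponent of a renewal [folklore] -/
theorem sharpT_kind1 {e : PEv} (h : e.kind = 1) : sharpT sB sR e = sR (e.step - 1) := by simp [sharpT, h]

/-- sharp exponent of a merger is `0` [folklore] -/
theorem sharpT_kind2 {e : PEv} (h : e.kind = 2) : sharpT sB sR e = 0 := by simp [sharpT, h]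

/-- **THE ROUNDING-WITH-ROOM JUNCTION** (HYPOTHESIS SHAPE, R-class reading; two clauses shaped like the END's pay
inequalities `Hb`∕`Hr`∕`Hm` of `HistoryBankingLE`, quantified over shapes and performed steps, uniform in the genealogy
and in `K`'s histories):
* `birth` — print's rounding of the fundamental large-field factor to the booked birth credit ((1.79) p. 383, `pcredit`
  of a kind-`0` shape) READ WITH ROOM for the birth's own discount share AND one merger share at any later performed step
  `s` (the merger that absorbs the structure rooted at this birth, if any — each root is absorbed at most once);
* `renew` — print's rounding of the largest preparatory factor to «exp(−p₀(g_j))» (p. 383 after (1.78), under the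
  exponent proviso «2p₁ − (d+5)r₀ > p₀»; `pcredit` of a kind-`1` shape at step `h + 1` is `p₀(g_h)`) READ WITH ROOM for
  the renewal's own discount share.
Nothing of Bałaban's is asserted: the structure is inhabited by toy data (sibling `HistoryBankingCreditRead` §4) and is
the supplier's to discharge (for print's exponents it is «g sufficiently small», as print's own roundings are). [folklore] -/
structure RoundingRoom (C : T4PrintedShapeBanking.Consts) (O : PrintedO1s) (L K : ℕ) (R : ℕ → ℕ) (g : ℕ → ℝ)
    (sB : ℕ → ℕ → ℝ) (sR : ℕ → ℝ) : Prop where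
  /-- births: booked credit + own share + one merger share at any later performed step ≤ sharp exponent -/
  birth : ∀ e : PEv, e.kind = 0 → ∀ s, e.step ≤ s → s ≤ K →
    pcredit O C g e + dshare C L R e + mshare C L R s ≤ sB e.step e.fat
  /-- renewals (event step `h + 1 ≥ 1`, performed): booked credit `p₀(g_h)` + own share ≤ sharp exponent -/
  renew : ∀ e : PEv, e.kind = 1 → 1 ≤ e.step → e.step ≤ K → pcredit O C g e + dshare C L R e ≤ sR (e.step - 1)

variable {ε : Type*} [DecidableEq ε] {sh : ε → PEv} {C : T4PrintedShapeBanking.Consts} {O : PrintedO1s} {L K : ℕ}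
  {R : ℕ → ℕ} {g : ℕ → ℝ}

/-- THE CHARGE WITH ONE MERGER SHARE IN HAND (the induction): for a `ConsistentTLE`, well-formed `G` and every performed
step `s ≥ rootStep G`, `credits (pcredit ∘ sh) G + Σ_e dshare (sh e) + mshare s ≤ Σ_e sharpT (sh e)` — at a merger the
absorbed (later-born) partner's invariant, taken at the merger step, pays the merger's share; the surviving root's
invariant is passed on. [folklore] -/
theorem credits_add_sum_dshare_add_mshare_le (hRR : RoundingRoom C O L K R g sB sR) :
    ∀ {G : Gen ε}, G.WF (dictWT sh R C.n₁) → ConsistentTLE sh C K R G → ∀ s, G.rootStep ≤ s → s ≤ K →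
      credits (pcredit O C g ∘ sh) G + (∑ e ∈ G.events, dshare C L R (sh e)) + mshare C L R s ≤
        ∑ e ∈ G.events, sharpT sB sR (sh e)
  | Gen.born b j, _, hc, s, hs, hsK => by
      simp only [ConsistentTLE] at hc
      obtain ⟨hk, hst, -⟩ := hc
      simp only [credits_born, Function.comp_apply, Gen.events_born, sum_singleton, Gen.rootStep_born] at hs ⊢
      rw [sharpT_kind0 hk]
      exact hRR.birth (sh b) hk s (hst ▸ hs) hsK
  | Gen.renew G e h, hW, hc, s, hs, hsK => by
      simp only [Gen.WF] at hW
      obtain ⟨hWG, he, -, -⟩ := hW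
      simp only [ConsistentTLE] at hc
      obtain ⟨hG, hk, hst, -, hK⟩ := hc
      rw [Gen.rootStep_renew] at hs
      have ih := credits_add_sum_dshare_add_mshare_le hRR hWG hG s hs hsK
      have hr := hRR.renew (sh e) hk (by omega) (by omega)
      rw [credits_renew _ h he, Gen.events_renew, sum_insert he, sum_insert he, sharpT_kind1 hk]
      simp only [Function.comp_apply] at ih hr ⊢
      linarith
  | Gen.merge X Y e, hW, hc, s, hs, hsK => by
      simp only [Gen.WF] at hW
      obtain ⟨hWX, hWY, heX, heY, hXY, -, -⟩ := hW
      simp only [ConsistentTLE] at hc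
      obtain ⟨hX, hY, hk, hxr, -, hyr, -, heK⟩ := hc
      have he : e ∉ X.events ∪ Y.events := by simp [heX, heY]
      rw [credits_merge _ heX heY hXY, Gen.events_merge, sum_insert he, sum_union hXY, sum_insert he, sum_union hXY,
        sharpT_kind2 hk, dshare_kind2 hk]
      simp only [Function.comp_apply, pcredit_kind2 hk]
      rw [Gen.rootStep_merge] at hs
      rcases le_total X.rootStep Y.rootStep with hle | hle
      · rw [min_eq_left hle] at hs
        have ihX := credits_add_sum_dshare_add_mshare_le hRR hWX hX s hs hsK
        have ihY := credits_add_sum_dshare_add_mshare_le hRR hWY hY (sh e).step hyr heK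
        linarith
      · rw [min_eq_right hle] at hs
        have ihX := credits_add_sum_dshare_add_mshare_le hRR hWX hX (sh e).step hxr heK
        have ihY := credits_add_sum_dshare_add_mshare_le hRR hWY hY s hs hsK
        linarith

/-- **THE CHARGE**: `credits (pcredit O C g ∘ sh) G + Σ_e dshare (sh e) ≤ Σ_e sharpT sB sR (sh e)` for every
`ConsistentTLE`, well-formed genealogy (the merger share in hand at the root step is dropped: `E₂, E₃ ≥ 0`). [folklore] -/
theorem credits_add_sum_dshare_le_sharps (hE₂ : 0 ≤ C.E₂) (hE₃ : 0 ≤ C.E₃) (hRR : RoundingRoom C O L K R g sB sR)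
    {G : Gen ε} (hW : G.WF (dictWT sh R C.n₁)) (hc : ConsistentTLE sh C K R G) :
    credits (pcredit O C g ∘ sh) G + ∑ e ∈ G.events, dshare C L R (sh e) ≤ ∑ e ∈ G.events, sharpT sB sR (sh e) := by
  have hroot : G.rootStep ≤ K := by
    rw [← (ConsistentTLE.root_spec hc).2]
    exact ConsistentTLE.step_le hc _ (Gen.root_mem G)
  have h := credits_add_sum_dshare_add_mshare_le hRR hW hc G.rootStep le_rfl hroot
  have h0 := mshare_nonneg (L := L) (R := R) hE₂ hE₃ G.rootStep
  linarith

end Charge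

/-! ## §5 The count's discount and print's booked credits are TOGETHER below the sharp exponents -/

section Assembly

variable {ε : Type*} [DecidableEq ε] {sh : ε → PEv} {C : T4PrintedShapeBanking.Consts} {O : PrintedO1s} {L K : ℕ}
  {R : ℕ → ℕ} {g : ℕ → ℝ} {β' β₀ : ℝ} {sB : ℕ → ℕ → ℝ} {sR : ℕ → ℝ}

/-- **`credits (pcredit ∘ sh) G + Ξ ≤ Σ_e sharpT (sh e)`** for every `ConsistentTLE`, well-formed genealogy, under the
rounding-with-room junction, (2.9) on the run, `L ≥ 1`, `E₂ > 0`, `E₃ ≥ 0` — the exponent form of M5-3: print's SHARP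
factors pay print's booked credits AND the count's displaced discount, event by event. [folklore] -/
theorem credits_add_discount_le_sharps (h29 : B14FlowStep.FlowIneq29 R g L β' β₀ K) (hL : 1 ≤ L) (hE₂ : 0 < C.E₂)
    (hE₃ : 0 ≤ C.E₃) (hRR : RoundingRoom C O L K R g sB sR) {G : Gen ε} (hW : G.WF (dictWT sh R C.n₁))
    (hc : ConsistentTLE sh C K R G) :
    credits (pcredit O C g ∘ sh) G +
        (8 / C.E₂ * totalCostT sh C K R G + 4 * (partnerAges (PEv.step ∘ sh) G : ℝ)) ≤
      ∑ e ∈ G.events, sharpT sB sR (sh e) := by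
  have h1 := discount_le_sum_dshare h29 hL hE₂ hE₃ hW hc
  have h2 := credits_add_sum_dshare_le_sharps hE₂.le hE₃ hRR hW hc
  linarith

/-- **… IN FACTOR FORM**: `exp (−Σ_e sharpT (sh e)) ≤ exp (−credits (pcredit ∘ sh) G) · exp (−Ξ)`. [folklore] -/
theorem exp_neg_sharps_le (h29 : B14FlowStep.FlowIneq29 R g L β' β₀ K) (hL : 1 ≤ L) (hE₂ : 0 < C.E₂)
    (hE₃ : 0 ≤ C.E₃) (hRR : RoundingRoom C O L K R g sB sR) {G : Gen ε} (hW : G.WF (dictWT sh R C.n₁))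
    (hc : ConsistentTLE sh C K R G) :
    Real.exp (-∑ e ∈ G.events, sharpT sB sR (sh e)) ≤
      Real.exp (-credits (pcredit O C g ∘ sh) G) *
        Real.exp (-(8 / C.E₂ * totalCostT sh C K R G + 4 * (partnerAges (PEv.step ∘ sh) G : ℝ))) := by
  rw [← Real.exp_add]
  exact Real.exp_le_exp.2 (by linarith [credits_add_discount_le_sharps h29 hL hE₂ hE₃ hRR hW hc])

end Assembly

end

end Summit.QuantumFields.BalabanUV.T4Continuum.HistoryBankingDiscountCharge
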